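import Literature.NumberTheory.Automorphic.IdelicDyadicUnfolding
import Literature.MeasureTheory.Group.DiscreteFundamentalDomain
import Mathlib.MeasureTheory.Measure.Haar.Unique
import Mathlib.Analysis.SpecialFunctions.ImproperIntegrals
import HarnessLib

/-!
# Integration on the idele group modulo `Kˣ` along the idele norm (Tate's volume computations)

Topic `NumberTheory/Automorphic`; namespace `Literature.NumberTheory.Automorphic`. Proof file
(everything proved; no named fact). The analytic continuation of Tate's zeta integrals
`ζ(f, |·|^s) = ∫_{𝕀_K} f(a) |a|^s da` and of the mirabolic Eisenstein series
`E(g, Φ; s) = |det g|^s ∑_{ξ} ∫_{𝔸_Kˣ} Φ(a ξ g) |a|^{ns} d^×a` (`MirabolicEisensteinSeries`;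
Jacquet–Shalika (1981), §4; Cogdell (2004), §2.3) near `s = 1` rests, after the Poisson summation
formula, on two measure-theoretic facts about the idele group `𝕀_K = 𝔸_Kˣ` and its discrete
subgroup `Kˣ`, both from Tate's thesis (J. Tate, *Fourier analysis in number fields and Hecke's
zeta-functions*, in Cassels–Fröhlich (eds.), *Algebraic Number Theory* (1967), Ch. XV): the
"multiplicative fundamental domain `E` for `J mod kˣ`" with "`J = ⋃_α α E`, a disjoint union" and
its volume `κ` (Thm. 4.3.2, PDF p. 364 of the held copy), and, in the proof of the Main Theorem
4.4.1 (PDF pp. 367–368), Lemma B "`∫_E c(t𝔟) d𝔟 = κ t^s` if `c(𝔞) = |𝔞|^s`" together with the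
evaluation of the auxiliary integrals
"`∫₀¹ κ f̂(0) (1/t)^{1-s} dt/t - ∫₀¹ κ f(0) t^s dt/t = κ f̂(0)/(s-1) - κ f(0)/s`" (`Re s > 1`),
i.e. `∫_{|𝔞| ≤ 1 mod kˣ} |𝔞|^s d𝔞 = κ / s`. We render "integration modulo `kˣ`" by integration over
a measurable fundamental domain `𝓕 ⊆ 𝕀_K` (Tate's `ℝ_{>0} · E`), for an arbitrary left-invariant
measure `ν` on `𝕀_K` finite on compact sets and positive on open sets (a Haar measure), and prove
that along `u = log |a|` the measure `ν|_𝓕` is `V du` for a constant `V = V(ν) ∈ (0, ∞)` (Tate's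
`κ` in his normalisation) — by the uniqueness of Haar measure on `ℝ` rather than by Tate's explicit
parametrisation `𝕀_K = ℝ_{>0} × J`:

* `IsIdeleClassDomain K 𝓕` — `𝓕` is Borel and contains exactly one point of every coset `Kˣ a`;
  `exists_isIdeleClassDomain` (**existence**, from the strict fundamental domains of discrete
  subgroups, `Literature.MeasureTheory.Group.DiscreteFundamentalDomain`; `Kˣ` is discrete in
  `𝕀_K`, `discreteTopology_principalIdeles` — Tate's Cor. 4.3.1); such an `𝓕` is a Mathlib
  `IsFundamentalDomain` for the multiplication action of `Kˣ` and every measure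
  (`IsIdeleClassDomain.isFundamentalDomain`), and `g • 𝓕`, `𝓕⁻¹` are again such
  (`IsIdeleClassDomain.smul`, `.inv`);
* **unfolding** `∫_{𝕀_K} f dν = ∫_𝓕 ∑_{k ∈ Kˣ} f(k x) dν(x)` for `f ≥ 0` measurable and for
  `f ∈ L¹` (`lintegral_eq_setLIntegral_tsum_smul`, `integral_eq_setIntegral_tsum_smul`, and the
  versions indexed by `Kˣ` through `principalIdele K`, `…_principalIdele`) — Tate's first step
  "because `J = ⋃ αE`, a disjoint union; `d(α𝔟) = d𝔟`" (Mathlib's `IsFundamentalDomain` API);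
* `logNorm K a = log |a|`; norm shells `{a ≤ log |x| ≤ b}` are covered by the `Kˣ`-translates of a
  compact set (`logNorm_preimage_Icc_subset_iUnion_smul`: `𝕀_K¹ = W Kˣ` with `W` compact,
  `NormOneIdeleClassCompact` / `IdelicDyadicUnfolding`), hence meet `𝓕` in finite measure
  (`measure_logNorm_preimage_Icc_inter_lt_top`);
* the **norm profile** `normProfile K ν 𝓕 = (ν|_𝓕) ∘ logNorm⁻¹` on `ℝ`: independent of `𝓕`
  (`normProfile_eq`, Mathlib `IsFundamentalDomain.measure_set_eq`), translation invariant
  (`isAddLeftInvariant_normProfile`: translate by a positive real idele and change fundamental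
  domain), finite on compact sets and positive on open sets, hence
  **`normProfile K ν 𝓕 = V • volume`** (`normProfile_eq_smul_volume`, Mathlib
  `Measure.isAddLeftInvariant_eq_smul`) with `V = idelicCovolume K ν`, `0 < V < ∞`
  (`idelicCovolume_pos`, `idelicCovolume_lt_top`);
* consequences: `setLIntegral_comp_logNorm_eq` / `setIntegral_comp_logNorm_eq`
  (`∫_{{log |x| ∈ B} ∩ 𝓕} f(log |x|) dν = V ∫_B f(u) du`), `integrableOn_comp_logNorm_iff`,
  `measure_setOf_ideleNorm_eq_one_inter_eq_zero` (`ν(𝓕 ∩ 𝕀_K¹) = 0`), and **Tate's formulas**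
  `integrableOn_and_setIntegral_ideleNorm_cpow` (`∫_{𝓕 ∩ {|x| ≤ 1}} |x|^{s} dν = V / s`) and
  `integrableOn_and_setIntegral_ideleNorm_cpow_neg` (`∫_{𝓕 ∩ {|x| ≥ 1}} |x|^{-s} dν = V / s`) for
  `re s > 0`, with absolute convergence.

## References

* J. Tate, *Fourier analysis in number fields and Hecke's zeta-functions* (1950), §4.3
  (Thm. 4.3.2, Cor. 4.3.1) and §4.4 (proof of Main Theorem 4.4.1, Lemmas A–B), in
  J. W. S. Cassels, A. Fröhlich (eds.), *Algebraic Number Theory* (1967), Ch. XV, PDF pp. 364–368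
  of the held copy [CasselsFrohlichANT1967].
* A. Weil, *Basic Number Theory* (1967), Ch. VII §5 [WeilBNT1967].
* H. Jacquet, J. A. Shalika, *On Euler products and the classification of automorphic
  representations I*, Amer. J. Math. 103 (1981), §4 [JacquetShalikaAJM1981].
-/

noncomputable section

open MeasureTheory Measure NumberField IsDedekindDomain Set Filter
open scoped ENNReal NNReal Pointwise Topology

namespace Literature.NumberTheory.Automorphic

variable (K : Type) [Field K] [NumberField K]

/-! ### The logarithmic idele norm -/

section LogNorm

/-- `log |a|` for an idele `a` (`|·| = ideleNorm K`, the `ℝ≥0`-valued idele norm). [folklore] -/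
def logNorm (a : GaloisRepresentations.ideleGroup K) : ℝ :=
  Real.log (IdeleClassGroup.ideleNorm K a : ℝ)

variable {K}

/-- The idele norm is positive (as a real number; cf. `ideleNorm_coe_pos` of
`RankinSelbergTorusPositivity`, not imported here). [folklore] -/
theorem ideleNorm_real_pos (a : GaloisRepresentations.ideleGroup K) :
    0 < (IdeleClassGroup.ideleNorm K a : ℝ) :=
  NNReal.coe_pos.2 (pos_iff_ne_zero.2 (ideleNorm_ne_zero a))

/-- `exp (log |a|) = |a|`. [folklore] -/
theorem exp_logNorm (a : GaloisRepresentations.ideleGroup K) :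
    Real.exp (logNorm K a) = (IdeleClassGroup.ideleNorm K a : ℝ) :=
  Real.exp_log (ideleNorm_real_pos a)

/-- `log |a b| = log |a| + log |b|`. [folklore] -/
theorem logNorm_mul (a b : GaloisRepresentations.ideleGroup K) :
    logNorm K (a * b) = logNorm K a + logNorm K b := by
  simp only [logNorm, map_mul, NNReal.coe_mul]
  exact Real.log_mul (ideleNorm_real_pos a).ne' (ideleNorm_real_pos b).ne'

/-- `log |1| = 0`. [folklore] -/
theorem logNorm_one : logNorm K 1 = 0 := by
  rw [logNorm, map_one, NNReal.coe_one, Real.log_one]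

/-- `log |a⁻¹| = - log |a|`. [folklore] -/
theorem logNorm_inv (a : GaloisRepresentations.ideleGroup K) : logNorm K a⁻¹ = -logNorm K a := by
  have h := logNorm_mul a⁻¹ a
  rw [inv_mul_cancel, logNorm_one] at h
  linarith

/-- Principal ideles have `log |k| = 0` (product formula). [folklore] -/
theorem logNorm_eq_zero_of_mem {k : GaloisRepresentations.ideleGroup K}
    (hk : k ∈ GaloisRepresentations.principalIdeles K) : logNorm K k = 0 := by
  simp [logNorm, ideleNorm_principal hk]

/-- `log |k a| = log |a|` for a principal idele `k`. [folklore] -/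
theorem logNorm_principal_mul {k : GaloisRepresentations.ideleGroup K}
    (hk : k ∈ GaloisRepresentations.principalIdeles K) (a : GaloisRepresentations.ideleGroup K) :
    logNorm K (k * a) = logNorm K a := by
  rw [logNorm_mul, logNorm_eq_zero_of_mem hk, zero_add]

variable (K) in
/-- `log |z(e^t)| = [K : ℚ] t` for the positive real idele `z(e^t)`. [folklore] -/
theorem logNorm_posRealIdele_expUnitNNReal (t : ℝ) :
    logNorm K (posRealIdele K (expUnitNNReal t)) = Module.finrank ℚ K * t := by
  rw [logNorm, ideleNorm_posRealIdele_expUnitNNReal, Real.log_exp]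

variable (K) in
/-- Every real number is `log |z|` for a positive real idele `z`. [folklore] -/
theorem exists_logNorm_posRealIdele_eq (t : ℝ) :
    ∃ r : ℝ≥0ˣ, logNorm K (posRealIdele K r) = t := by
  have hd : (0 : ℝ) < Module.finrank ℚ K := Nat.cast_pos.2 Module.finrank_pos
  exact ⟨expUnitNNReal (t / Module.finrank ℚ K), by
    rw [logNorm_posRealIdele_expUnitNNReal, mul_div_cancel₀ _ hd.ne']⟩

variable (K) in
/-- `a ↦ log |a|` is continuous on `𝕀_K`. [folklore] -/
theorem continuous_logNorm : Continuous (logNorm K) := by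
  have hc : Continuous fun x : GaloisRepresentations.ideleGroup K => (IdeleClassGroup.ideleNorm K x : ℝ) :=
    NNReal.continuous_coe.comp (continuous_ideleNorm_holds K)
  exact hc.log fun a => (ideleNorm_real_pos a).ne'

/-- `|a| ^ s = exp (s log |a|)` (principal complex power of the positive real `|a|`). [folklore] -/
theorem ideleNorm_cpow_eq_exp (a : GaloisRepresentations.ideleGroup K) (s : ℂ) :
    ((IdeleClassGroup.ideleNorm K a : ℝ) : ℂ) ^ s = Complex.exp (s * logNorm K a) := by
  rw [Complex.cpow_def_of_ne_zero (by exact_mod_cast (ideleNorm_real_pos a).ne'),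
    ← Complex.ofReal_log (ideleNorm_real_pos a).le, mul_comm]
  rfl

/-- `{1 ≤ |x|} = {0 ≤ log |x|}`. [folklore] -/
theorem setOf_one_le_ideleNorm_eq :
    {x : GaloisRepresentations.ideleGroup K | 1 ≤ (IdeleClassGroup.ideleNorm K x : ℝ)} = logNorm K ⁻¹' Ici 0 := by
  ext x
  simp only [Set.mem_setOf_eq, Set.mem_preimage, Set.mem_Ici, logNorm]
  exact (Real.log_nonneg_iff (ideleNorm_real_pos x)).symm

/-- `{|x| ≤ 1} = {log |x| ≤ 0}`. [folklore] -/
theorem setOf_ideleNorm_le_one_eq :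
    {x : GaloisRepresentations.ideleGroup K | (IdeleClassGroup.ideleNorm K x : ℝ) ≤ 1} = logNorm K ⁻¹' Iic 0 := by
  ext x
  simp only [Set.mem_setOf_eq, Set.mem_preimage, Set.mem_Iic, logNorm]
  exact (Real.log_nonpos_iff (ideleNorm_real_pos x).le).symm

/-- `{|x| = 1} = {log |x| = 0}`. [folklore] -/
theorem setOf_ideleNorm_eq_one_eq :
    {x : GaloisRepresentations.ideleGroup K | (IdeleClassGroup.ideleNorm K x : ℝ) = 1} = logNorm K ⁻¹' {0} := by
  ext x
  simp only [Set.mem_setOf_eq, Set.mem_preimage, Set.mem_singleton_iff, logNorm]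
  constructor
  · intro h; rw [h, Real.log_one]
  · intro h; exact Real.eq_one_of_pos_of_log_eq_zero (ideleNorm_real_pos x) h

end LogNorm

/-! ### Strict fundamental domains for `Kˣ` in `𝕀_K` -/

section Domain

/-- **An idele class domain**: a Borel subset `𝓕 ⊆ 𝕀_K` containing exactly one point of every
coset `Kˣ a` — a strict measurable fundamental domain for the (left = right) multiplication
action of the principal ideles. [folklore] -/
structure IsIdeleClassDomain [MeasurableSpace (GaloisRepresentations.ideleGroup K)]
    (𝓕 : Set (GaloisRepresentations.ideleGroup K)) : Prop where
  measurableSet : MeasurableSet 𝓕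
  existsUnique : ∀ a : GaloisRepresentations.ideleGroup K,
    ∃! k : GaloisRepresentations.principalIdeles K, k • a ∈ 𝓕

/-- `Kˣ` is countable, hence so is the group of principal ideles. [folklore] -/
instance countable_principalIdeles : Countable (GaloisRepresentations.principalIdeles K) := by
  haveI : Countable Kˣ := by
    haveI := countable_numberField K
    exact Function.Injective.countable (f := (Units.val : Kˣ → K)) Units.val_injective
  change Countable (MonoidHom.range _)
  exact Set.countable_range _ |>.to_subtype

variable {K}

/-- `k • a ∈ g • 𝓕 ↔ k • (g⁻¹ a) ∈ 𝓕` for a principal idele `k` (`𝕀_K` is commutative). [folklore] -/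
theorem principalIdeles_smul_mem_smul_set_iff {𝓕 : Set (GaloisRepresentations.ideleGroup K)}
    (k : GaloisRepresentations.principalIdeles K) (g a : GaloisRepresentations.ideleGroup K) :
    k • a ∈ g • 𝓕 ↔ k • (g⁻¹ * a) ∈ 𝓕 := by
  rw [Set.mem_smul_set_iff_inv_smul_mem, smul_eq_mul, Subgroup.smul_def, Subgroup.smul_def,
    smul_eq_mul, smul_eq_mul, mul_left_comm]

/-- `k • a ∈ 𝓕⁻¹ ↔ k⁻¹ • a⁻¹ ∈ 𝓕` for a principal idele `k`. [folklore] -/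
theorem principalIdeles_smul_mem_inv_iff {𝓕 : Set (GaloisRepresentations.ideleGroup K)}
    (k : GaloisRepresentations.principalIdeles K) (a : GaloisRepresentations.ideleGroup K) :
    k • a ∈ 𝓕⁻¹ ↔ k⁻¹ • a⁻¹ ∈ 𝓕 := by
  rw [Set.mem_inv, Subgroup.smul_def, Subgroup.smul_def, smul_eq_mul, smul_eq_mul, mul_inv_rev,
    Subgroup.coe_inv, mul_comm]

variable [MeasurableSpace (GaloisRepresentations.ideleGroup K)]

/-- An idele class domain is a Mathlib fundamental domain for the multiplication action of `Kˣ`,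
for every measure. [folklore] -/
theorem IsIdeleClassDomain.isFundamentalDomain {𝓕 : Set (GaloisRepresentations.ideleGroup K)}
    (h : IsIdeleClassDomain K 𝓕) (ν : Measure (GaloisRepresentations.ideleGroup K)) :
    IsFundamentalDomain (GaloisRepresentations.principalIdeles K) 𝓕 ν :=
  IsFundamentalDomain.mk' h.measurableSet.nullMeasurableSet h.existsUnique

variable [MeasurableMul (GaloisRepresentations.ideleGroup K)] in
/-- Translates of an idele class domain are idele class domains (`𝕀_K` is commutative).
[folklore] -/
theorem IsIdeleClassDomain.smul {𝓕 : Set (GaloisRepresentations.ideleGroup K)}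
    (h : IsIdeleClassDomain K 𝓕) (g : GaloisRepresentations.ideleGroup K) : IsIdeleClassDomain K (g • 𝓕) := by
  refine ⟨h.measurableSet.const_smul g, fun a => ?_⟩
  obtain ⟨k, hk, huniq⟩ := h.existsUnique (g⁻¹ * a)
  refine ⟨k, ?_, fun k' hk' => huniq k' ?_⟩
  · show k • a ∈ g • 𝓕
    exact (principalIdeles_smul_mem_smul_set_iff k g a).2 hk
  · show k' • (g⁻¹ * a) ∈ 𝓕
    exact (principalIdeles_smul_mem_smul_set_iff k' g a).1 hk'

variable [MeasurableInv (GaloisRepresentations.ideleGroup K)] in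
/-- The inverse of an idele class domain is an idele class domain. [folklore] -/
theorem IsIdeleClassDomain.inv {𝓕 : Set (GaloisRepresentations.ideleGroup K)}
    (h : IsIdeleClassDomain K 𝓕) : IsIdeleClassDomain K 𝓕⁻¹ := by
  refine ⟨h.measurableSet.inv, fun a => ?_⟩
  obtain ⟨k, hk, huniq⟩ := h.existsUnique a⁻¹
  refine ⟨k⁻¹, ?_, fun k' hk' => ?_⟩
  · show k⁻¹ • a ∈ 𝓕⁻¹
    rw [principalIdeles_smul_mem_inv_iff, inv_inv]
    exact hk
  · have hk'' : k'⁻¹ • a⁻¹ ∈ 𝓕 := (principalIdeles_smul_mem_inv_iff k' a).1 hk'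
    rw [← huniq k'⁻¹ hk'', inv_inv]

variable (K)
variable [BorelSpace (GaloisRepresentations.ideleGroup K)]

/-- **Existence of idele class domains.** `Kˣ` is a discrete subgroup of the second countable
group `𝕀_K` (`discreteTopology_principalIdeles`, `secondCountableTopology_ideleGroup`), so it has
a strict Borel fundamental domain (`Subgroup.exists_measurableSet_existsUnique_smul_mem` of
`Literature.MeasureTheory.Group.DiscreteFundamentalDomain`). [folklore] -/
theorem exists_isIdeleClassDomain : ∃ 𝓕 : Set (GaloisRepresentations.ideleGroup K), IsIdeleClassDomain K 𝓕 := by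
  haveI := discreteTopology_principalIdeles K
  haveI := secondCountableTopology_ideleGroup K
  obtain ⟨𝓕, h𝓕m, h𝓕⟩ :=
    Literature.MeasureTheory.Group.Subgroup.exists_measurableSet_existsUnique_smul_mem
      (GaloisRepresentations.principalIdeles K)
  exact ⟨𝓕, ⟨h𝓕m, h𝓕⟩⟩

end Domain

/-! ### Norm shells are covered by the `Kˣ`-translates of a compact set -/

section Shell

/-- The positive real ideles `z(e^t)` with `[K : ℚ] t ∈ [a, b]`, i.e. with `log |z| ∈ [a, b]`: a
compact segment of the split torus `A_G`. [folklore] -/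
def posRealIdeleIcc (a b : ℝ) : Set (GaloisRepresentations.ideleGroup K) :=
  (fun t : ℝ => posRealIdele K (expUnitNNReal t)) ''
    Icc (a / Module.finrank ℚ K) (b / Module.finrank ℚ K)

/-- The segment is compact. [folklore] -/
theorem isCompact_posRealIdeleIcc (a b : ℝ) : IsCompact (posRealIdeleIcc K a b) :=
  isCompact_Icc.image ((continuous_posRealIdele K).comp continuous_expUnitNNReal)

/-- Every `u ∈ [a, b]` is `log |p|` for some `p` in the segment. [folklore] -/
theorem exists_mem_posRealIdeleIcc_logNorm_eq {a b u : ℝ} (hu : u ∈ Icc a b) :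
    ∃ p ∈ posRealIdeleIcc K a b, logNorm K p = u := by
  have hd : (0 : ℝ) < Module.finrank ℚ K := Nat.cast_pos.2 Module.finrank_pos
  refine ⟨posRealIdele K (expUnitNNReal (u / Module.finrank ℚ K)), ⟨_, ⟨?_, ?_⟩, rfl⟩, ?_⟩
  · exact div_le_div_of_nonneg_right hu.1 hd.le
  · exact div_le_div_of_nonneg_right hu.2 hd.le
  · rw [logNorm_posRealIdele_expUnitNNReal, mul_div_cancel₀ _ hd.ne']

/-- The compact set `P_{[a,b]} · W` (`W = normOneIdeleCover K`, `𝕀_K¹ = W Kˣ`). [folklore] -/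
def shellCover (a b : ℝ) : Set (GaloisRepresentations.ideleGroup K) :=
  posRealIdeleIcc K a b * normOneIdeleCover K

/-- `P_{[a,b]} · W` is compact. [folklore] -/
theorem isCompact_shellCover (a b : ℝ) : IsCompact (shellCover K a b) :=
  (isCompact_posRealIdeleIcc K a b).mul (isCompact_normOneIdeleCover K)

/-- **Covering of a norm shell.** Every idele with `log |x| ∈ [a, b]` is `k · y` with `k ∈ Kˣ` and
`y ∈ P_{[a,b]} · W`: divide by a positive real idele of the same norm and use `𝕀_K¹ = W · Kˣ`
(`exists_mem_normOneIdeleCover_mul_principalIdele`; Tate (1967), Thm. 4.3.2 (1) and Cor. 4.3.1: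
"`J mod kˣ` is compact"). [cite: CasselsFrohlichANT1967, Ch. XV Thm. 4.3.2] -/
theorem logNorm_preimage_Icc_subset_iUnion_smul (a b : ℝ) :
    logNorm K ⁻¹' Icc a b ⊆
      ⋃ k : GaloisRepresentations.principalIdeles K, k • shellCover K a b := by
  intro x hx
  obtain ⟨p, hp, hpu⟩ := exists_mem_posRealIdeleIcc_logNorm_eq K (u := logNorm K x) hx
  have h1 : IdeleClassGroup.ideleNorm K (x * p⁻¹) = 1 := by
    have hreal : (IdeleClassGroup.ideleNorm K x : ℝ) = IdeleClassGroup.ideleNorm K p := by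
      rw [← exp_logNorm, ← exp_logNorm, hpu]
    apply NNReal.eq
    rw [map_mul, map_inv, NNReal.coe_mul, NNReal.coe_inv, hreal,
      mul_inv_cancel₀ (ideleNorm_real_pos p).ne', NNReal.coe_one]
  obtain ⟨k, w, hw, hkw⟩ := exists_mem_normOneIdeleCover_mul_principalIdele K h1
  refine Set.mem_iUnion.2 ⟨⟨principalIdele K k, ⟨k, rfl⟩⟩, ?_⟩
  refine Set.mem_smul_set.2 ⟨p * w, Set.mul_mem_mul hp hw, ?_⟩
  show principalIdele K k * (p * w) = x
  calc principalIdele K k * (p * w) = (w * principalIdele K k) * p := by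
        simp only [mul_assoc, mul_comm]
    _ = x * p⁻¹ * p := by rw [← hkw]
    _ = x := inv_mul_cancel_right x p

variable {K}

/-- Norm shells `{log |x| ∈ B}` are `Kˣ`-invariant. [folklore] -/
theorem smul_logNorm_preimage (k : GaloisRepresentations.principalIdeles K) (B : Set ℝ) :
    (fun x => k • x) ⁻¹' (logNorm K ⁻¹' B) = logNorm K ⁻¹' B := by
  ext x
  simp only [Set.mem_preimage, Subgroup.smul_def, smul_eq_mul, logNorm_principal_mul k.2]

variable [MeasurableSpace (GaloisRepresentations.ideleGroup K)] [BorelSpace (GaloisRepresentations.ideleGroup K)]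

/-- Norm shells `{a ≤ log |x| ≤ b}` are Borel. [folklore] -/
theorem measurableSet_logNorm_preimage {B : Set ℝ} (hB : MeasurableSet B) :
    MeasurableSet (logNorm K ⁻¹' B) :=
  (continuous_logNorm K).measurable hB

/-- **A fundamental domain meets a set covered by `Kˣ`-translates of `W` in measure at most
`ν(W)`**: `ν(A ∩ 𝓕) ≤ ∑_k ν(k W ∩ 𝓕) = ν(W)` (Mathlib `IsFundamentalDomain.measure_eq_tsum`).
[folklore] -/
theorem measure_inter_le_of_subset_iUnion_smul {𝓕 : Set (GaloisRepresentations.ideleGroup K)}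
    (ν : Measure (GaloisRepresentations.ideleGroup K)) [ν.IsMulLeftInvariant]
    (h𝓕 : IsFundamentalDomain (GaloisRepresentations.principalIdeles K) 𝓕 ν)
    {A W : Set (GaloisRepresentations.ideleGroup K)}
    (hAW : A ⊆ ⋃ k : GaloisRepresentations.principalIdeles K, k • W) : ν (A ∩ 𝓕) ≤ ν W := by
  haveI : MeasurableMul (GaloisRepresentations.ideleGroup K) := by
    haveI := secondCountableTopology_ideleGroup K
    infer_instance
  calc ν (A ∩ 𝓕) ≤ ν ((⋃ k : GaloisRepresentations.principalIdeles K, k • W) ∩ 𝓕) :=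
        measure_mono (Set.inter_subset_inter_left _ hAW)
    _ = ν (⋃ k : GaloisRepresentations.principalIdeles K, k • W ∩ 𝓕) := by rw [Set.iUnion_inter]
    _ ≤ ∑' k : GaloisRepresentations.principalIdeles K, ν (k • W ∩ 𝓕) := measure_iUnion_le _
    _ = ν W := (h𝓕.measure_eq_tsum W).symm

/-- **Norm shells have finite measure modulo `Kˣ`**: `ν({a ≤ log |x| ≤ b} ∩ 𝓕) < ∞` for a
fundamental domain `𝓕` and a left-invariant measure finite on compact sets. [folklore] -/
theorem measure_logNorm_preimage_Icc_inter_lt_top {𝓕 : Set (GaloisRepresentations.ideleGroup K)}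
    (ν : Measure (GaloisRepresentations.ideleGroup K)) [ν.IsMulLeftInvariant] [IsFiniteMeasureOnCompacts ν]
    (h𝓕 : IsFundamentalDomain (GaloisRepresentations.principalIdeles K) 𝓕 ν) (a b : ℝ) :
    ν (logNorm K ⁻¹' Icc a b ∩ 𝓕) < ⊤ :=
  (measure_inter_le_of_subset_iUnion_smul ν h𝓕 (logNorm_preimage_Icc_subset_iUnion_smul K a b)).trans_lt
    (isCompact_shellCover K a b).measure_lt_top

end Shell

/-! ### The norm profile of a fundamental domain -/

section Profile

variable [MeasurableSpace (GaloisRepresentations.ideleGroup K)] [BorelSpace (GaloisRepresentations.ideleGroup K)]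

/-- **The norm profile** of `ν` on `𝓕`: the image on `ℝ` of `ν` restricted to `𝓕` under
`x ↦ log |x|`, i.e. `B ↦ ν({log |x| ∈ B} ∩ 𝓕)`. [folklore] -/
def normProfile (ν : Measure (GaloisRepresentations.ideleGroup K)) (𝓕 : Set (GaloisRepresentations.ideleGroup K)) :
    Measure ℝ :=
  Measure.map (logNorm K) (ν.restrict 𝓕)

variable {K}

/-- `normProfile ν 𝓕 B = ν({log |x| ∈ B} ∩ 𝓕)`. [folklore] -/
theorem normProfile_apply (ν : Measure (GaloisRepresentations.ideleGroup K))
    (𝓕 : Set (GaloisRepresentations.ideleGroup K)) {B : Set ℝ} (hB : MeasurableSet B) :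
    normProfile K ν 𝓕 B = ν (logNorm K ⁻¹' B ∩ 𝓕) := by
  rw [normProfile, Measure.map_apply (continuous_logNorm K).measurable hB, Measure.restrict_apply
    (measurableSet_logNorm_preimage hB)]

/-- **The norm profile does not depend on the fundamental domain.** [folklore] -/
theorem normProfile_eq (ν : Measure (GaloisRepresentations.ideleGroup K)) [ν.IsMulLeftInvariant]
    {𝓕 𝓕' : Set (GaloisRepresentations.ideleGroup K)}
    (h𝓕 : IsFundamentalDomain (GaloisRepresentations.principalIdeles K) 𝓕 ν)
    (h𝓕' : IsFundamentalDomain (GaloisRepresentations.principalIdeles K) 𝓕' ν) :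
    normProfile K ν 𝓕 = normProfile K ν 𝓕' := by
  haveI : MeasurableMul (GaloisRepresentations.ideleGroup K) := by
    haveI := secondCountableTopology_ideleGroup K
    infer_instance
  ext B hB
  rw [normProfile_apply ν 𝓕 hB, normProfile_apply ν 𝓕' hB]
  exact h𝓕.measure_set_eq h𝓕' (measurableSet_logNorm_preimage hB) fun k => smul_logNorm_preimage k B

/-- **Translation invariance of the norm profile.** Translating by `t = log |g|`:
`{log |x| ∈ t + B} = g · {log |x| ∈ B}`, and
`ν(g A ∩ 𝓕) = ν(A ∩ g⁻¹ 𝓕) = ν(A ∩ 𝓕)` by left invariance of `ν` and independence of the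
fundamental domain (`g⁻¹ 𝓕` is again one, `IsFundamentalDomain.smul_of_comm`); every real `t`
is `log |g|` for a positive real idele `g`. [folklore] -/
theorem isAddLeftInvariant_normProfile (ν : Measure (GaloisRepresentations.ideleGroup K)) [ν.IsMulLeftInvariant]
    {𝓕 : Set (GaloisRepresentations.ideleGroup K)}
    (h𝓕 : IsFundamentalDomain (GaloisRepresentations.principalIdeles K) 𝓕 ν) :
    (normProfile K ν 𝓕).IsAddLeftInvariant := by
  haveI : MeasurableMul (GaloisRepresentations.ideleGroup K) := by
    haveI := secondCountableTopology_ideleGroup K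
    infer_instance
  haveI : SMulCommClass (GaloisRepresentations.ideleGroup K) (GaloisRepresentations.principalIdeles K)
      (GaloisRepresentations.ideleGroup K) :=
    ⟨fun g k x => by simp only [Subgroup.smul_def, smul_eq_mul, mul_left_comm]⟩
  refine ⟨fun t => ?_⟩
  obtain ⟨r, hr⟩ := exists_logNorm_posRealIdele_eq K t
  set g : GaloisRepresentations.ideleGroup K := posRealIdele K r with hg
  ext B hB
  rw [Measure.map_apply (measurable_const_add t) hB, normProfile_apply ν 𝓕 hB,
    normProfile_apply ν 𝓕 (measurable_const_add t hB)]
  -- `{log |x| ∈ (t + ·)⁻¹ B} = g⁻¹ • {log |x| ∈ B}`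
  have hset : logNorm K ⁻¹' ((fun u => t + u) ⁻¹' B) = g⁻¹ • (logNorm K ⁻¹' B) := by
    ext x
    rw [Set.mem_smul_set_iff_inv_smul_mem, inv_inv, smul_eq_mul, Set.mem_preimage, Set.mem_preimage,
      Set.mem_preimage, logNorm_mul, hr]
  rw [hset]
  have hfd : IsFundamentalDomain (GaloisRepresentations.principalIdeles K) (g • 𝓕) ν := h𝓕.smul_of_comm g
  calc ν (g⁻¹ • (logNorm K ⁻¹' B) ∩ 𝓕) = ν (g⁻¹ • (logNorm K ⁻¹' B ∩ g • 𝓕)) := by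
        rw [Set.smul_set_inter, inv_smul_smul]
    _ = ν (logNorm K ⁻¹' B ∩ g • 𝓕) := measure_smul _ _ _
    _ = ν (logNorm K ⁻¹' B ∩ 𝓕) :=
        hfd.measure_set_eq h𝓕 (measurableSet_logNorm_preimage hB) fun k => smul_logNorm_preimage k B

/-- The norm profile is finite on compact sets. [folklore] -/
theorem isFiniteMeasureOnCompacts_normProfile (ν : Measure (GaloisRepresentations.ideleGroup K))
    [ν.IsMulLeftInvariant] [IsFiniteMeasureOnCompacts ν] {𝓕 : Set (GaloisRepresentations.ideleGroup K)}
    (h𝓕 : IsFundamentalDomain (GaloisRepresentations.principalIdeles K) 𝓕 ν) :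
    IsFiniteMeasureOnCompacts (normProfile K ν 𝓕) := by
  refine ⟨fun C hC => ?_⟩
  have hCb : C ⊆ Icc (sInf C) (sSup C) := hC.isBounded.subset_Icc_sInf_sSup
  calc normProfile K ν 𝓕 C ≤ normProfile K ν 𝓕 (Icc (sInf C) (sSup C)) := measure_mono hCb
    _ = ν (logNorm K ⁻¹' Icc (sInf C) (sSup C) ∩ 𝓕) := normProfile_apply ν 𝓕 measurableSet_Icc
    _ < ⊤ := measure_logNorm_preimage_Icc_inter_lt_top ν h𝓕 _ _

/-- **Positivity.** For a left-invariant measure positive on open sets, the norm profile of a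
fundamental domain charges every non-empty open set: otherwise the `Kˣ`-invariant open set
`{log |x| ∈ U} ≠ ∅` would be `ν`-null (`IsFundamentalDomain.measure_zero_of_invariant`). [folklore] -/
theorem normProfile_pos_of_isOpen (ν : Measure (GaloisRepresentations.ideleGroup K)) [ν.IsMulLeftInvariant]
    [ν.IsOpenPosMeasure] {𝓕 : Set (GaloisRepresentations.ideleGroup K)}
    (h𝓕 : IsFundamentalDomain (GaloisRepresentations.principalIdeles K) 𝓕 ν) {U : Set ℝ}
    (hU : IsOpen U) (hne : U.Nonempty) : 0 < normProfile K ν 𝓕 U := by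
  haveI : MeasurableMul (GaloisRepresentations.ideleGroup K) := by
    haveI := secondCountableTopology_ideleGroup K
    infer_instance
  rw [normProfile_apply ν 𝓕 hU.measurableSet, pos_iff_ne_zero]
  intro h0
  have hinv : ∀ k : GaloisRepresentations.principalIdeles K, k • (logNorm K ⁻¹' U) = logNorm K ⁻¹' U := by
    intro k
    rw [← preimage_smul_inv, smul_logNorm_preimage]
  have hzero : ν (logNorm K ⁻¹' U) = 0 := h𝓕.measure_zero_of_invariant _ hinv h0
  obtain ⟨t, ht⟩ := hne
  obtain ⟨r, hr⟩ := exists_logNorm_posRealIdele_eq K t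
  have hpos : 0 < ν (logNorm K ⁻¹' U) :=
    (hU.preimage (continuous_logNorm K)).measure_pos ν ⟨posRealIdele K r, by rwa [Set.mem_preimage, hr]⟩
  exact hpos.ne' hzero

variable (K)

/-- **The idelic covolume constant** `V = V(ν)`: the `ν`-measure, inside a (chosen) idele class
domain, of the shell `{0 ≤ log |x| < 1}`; by `normProfile_eq_smul_volume` it is the density of the
norm profile against Lebesgue measure, i.e. `vol(𝕀_K¹ / Kˣ)` for the disintegration
`dν = dν¹ du` of `ν` along `u = log |x|` (Tate's `κ`-type constant, up to his normalisations).
[folklore] -/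
def idelicCovolume (ν : Measure (GaloisRepresentations.ideleGroup K)) : ℝ≥0∞ :=
  ν (logNorm K ⁻¹' Ico 0 1 ∩ (exists_isIdeleClassDomain K).choose)

variable {K}

/-- `V = normProfile ν 𝓕 [0, 1)` for **every** fundamental domain `𝓕`. [folklore] -/
theorem normProfile_Ico_eq_idelicCovolume (ν : Measure (GaloisRepresentations.ideleGroup K)) [ν.IsMulLeftInvariant]
    {𝓕 : Set (GaloisRepresentations.ideleGroup K)}
    (h𝓕 : IsFundamentalDomain (GaloisRepresentations.principalIdeles K) 𝓕 ν) :
    normProfile K ν 𝓕 (Ico 0 1) = idelicCovolume K ν := by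
  rw [normProfile_eq ν h𝓕 ((exists_isIdeleClassDomain K).choose_spec.isFundamentalDomain ν),
    normProfile_apply ν _ measurableSet_Ico]
  rfl

/-- **The norm profile is `V` times Lebesgue measure**: along `u = log |x|`, a left-invariant
measure finite on compact sets, restricted to a fundamental domain for `Kˣ`, is `V du` (uniqueness
of Haar measure on `ℝ`, Mathlib `Measure.isAddLeftInvariant_eq_smul`) — the tree's form of Tate's
`d𝔞 = d𝔟 dt/t` on `I = J × ℝ_{>0}` with `∫_E d𝔟 = κ` (Tate (1967), Thm. 4.3.2 and Lemma B in the
proof of Thm. 4.4.1). [cite: CasselsFrohlichANT1967, Ch. XV Thm. 4.3.2] -/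
theorem normProfile_eq_smul_volume (ν : Measure (GaloisRepresentations.ideleGroup K)) [ν.IsMulLeftInvariant]
    [IsFiniteMeasureOnCompacts ν] {𝓕 : Set (GaloisRepresentations.ideleGroup K)}
    (h𝓕 : IsFundamentalDomain (GaloisRepresentations.principalIdeles K) 𝓕 ν) :
    normProfile K ν 𝓕 = idelicCovolume K ν • (volume : Measure ℝ) := by
  haveI := isAddLeftInvariant_normProfile ν h𝓕
  haveI := isFiniteMeasureOnCompacts_normProfile ν h𝓕
  have h := Measure.isAddLeftInvariant_eq_smul (normProfile K ν 𝓕) (volume : Measure ℝ)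
  have hc : (Measure.addHaarScalarFactor (normProfile K ν 𝓕) (volume : Measure ℝ) : ℝ≥0∞) =
      idelicCovolume K ν := by
    have h1 : normProfile K ν 𝓕 (Ico 0 1) =
        (Measure.addHaarScalarFactor (normProfile K ν 𝓕) (volume : Measure ℝ) • (volume : Measure ℝ))
          (Ico 0 1) := by rw [← h]
    rw [Measure.coe_nnreal_smul_apply, Real.volume_Ico, sub_zero, ENNReal.ofReal_one, mul_one,
      normProfile_Ico_eq_idelicCovolume ν h𝓕] at h1
    exact h1.symm
  rw [h]
  ext B hB
  rw [Measure.coe_nnreal_smul_apply, Measure.smul_apply, smul_eq_mul, hc]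

/-- `V < ∞`. [folklore] -/
theorem idelicCovolume_lt_top (ν : Measure (GaloisRepresentations.ideleGroup K)) [ν.IsMulLeftInvariant]
    [IsFiniteMeasureOnCompacts ν] : idelicCovolume K ν < ⊤ := by
  have h𝓕 := (exists_isIdeleClassDomain K).choose_spec.isFundamentalDomain ν
  calc idelicCovolume K ν ≤ ν (logNorm K ⁻¹' Icc 0 1 ∩ (exists_isIdeleClassDomain K).choose) :=
        measure_mono (Set.inter_subset_inter_left _ (Set.preimage_mono Set.Ico_subset_Icc_self))
    _ < ⊤ := measure_logNorm_preimage_Icc_inter_lt_top ν h𝓕 0 1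

/-- `V ≠ ∞`. [folklore] -/
theorem idelicCovolume_ne_top (ν : Measure (GaloisRepresentations.ideleGroup K)) [ν.IsMulLeftInvariant]
    [IsFiniteMeasureOnCompacts ν] : idelicCovolume K ν ≠ ⊤ :=
  (idelicCovolume_lt_top ν).ne

/-- `V > 0` for a left-invariant measure positive on open sets (e.g. a Haar measure). [folklore] -/
theorem idelicCovolume_pos (ν : Measure (GaloisRepresentations.ideleGroup K)) [ν.IsMulLeftInvariant]
    [ν.IsOpenPosMeasure] : 0 < idelicCovolume K ν := by
  have h𝓕 := (exists_isIdeleClassDomain K).choose_spec.isFundamentalDomain ν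
  rw [← normProfile_Ico_eq_idelicCovolume ν h𝓕]
  exact (normProfile_pos_of_isOpen ν h𝓕 isOpen_Ioo ⟨1 / 2, by norm_num, by norm_num⟩).trans_le
    (measure_mono Set.Ioo_subset_Ico_self)

/-- `V ≠ 0` for a left-invariant measure positive on open sets. [folklore] -/
theorem idelicCovolume_ne_zero (ν : Measure (GaloisRepresentations.ideleGroup K)) [ν.IsMulLeftInvariant]
    [ν.IsOpenPosMeasure] : idelicCovolume K ν ≠ 0 :=
  (idelicCovolume_pos ν).ne'

/-! ### Integration along the norm -/

/-- The restriction of `ν` to `{log |x| ∈ B} ∩ 𝓕`, pushed to `ℝ`, is `V du|_B`. [folklore] -/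
theorem map_logNorm_restrict_eq (ν : Measure (GaloisRepresentations.ideleGroup K)) [ν.IsMulLeftInvariant]
    [IsFiniteMeasureOnCompacts ν] {𝓕 : Set (GaloisRepresentations.ideleGroup K)}
    (h𝓕 : IsFundamentalDomain (GaloisRepresentations.principalIdeles K) 𝓕 ν) {B : Set ℝ}
    (hB : MeasurableSet B) :
    Measure.map (logNorm K) (ν.restrict (logNorm K ⁻¹' B ∩ 𝓕)) =
      idelicCovolume K ν • (volume.restrict B : Measure ℝ) := by
  rw [← Measure.restrict_restrict (measurableSet_logNorm_preimage hB),
    ← Measure.restrict_map (continuous_logNorm K).measurable hB, ← normProfile,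
    normProfile_eq_smul_volume ν h𝓕, Measure.restrict_smul]

/-- **Integration along the norm, `ℝ≥0∞` version**: for measurable `f ≥ 0` and Borel `B ⊆ ℝ`,
`∫⁻_{{log |x| ∈ B} ∩ 𝓕} f(log |x|) dν = V ∫⁻_B f(u) du`. [folklore] -/
theorem setLIntegral_comp_logNorm_eq (ν : Measure (GaloisRepresentations.ideleGroup K)) [ν.IsMulLeftInvariant]
    [IsFiniteMeasureOnCompacts ν] {𝓕 : Set (GaloisRepresentations.ideleGroup K)}
    (h𝓕 : IsFundamentalDomain (GaloisRepresentations.principalIdeles K) 𝓕 ν) {B : Set ℝ}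
    (hB : MeasurableSet B) {f : ℝ → ℝ≥0∞} (hf : Measurable f) :
    ∫⁻ x in logNorm K ⁻¹' B ∩ 𝓕, f (logNorm K x) ∂ν = idelicCovolume K ν * ∫⁻ u in B, f u := by
  rw [← lintegral_map hf (continuous_logNorm K).measurable, map_logNorm_restrict_eq ν h𝓕 hB,
    lintegral_smul_measure, smul_eq_mul]

/-- The whole fundamental domain: `∫⁻_𝓕 f(log |x|) dν = V ∫⁻_ℝ f(u) du`. [folklore] -/
theorem lintegral_comp_logNorm_eq (ν : Measure (GaloisRepresentations.ideleGroup K)) [ν.IsMulLeftInvariant]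
    [IsFiniteMeasureOnCompacts ν] {𝓕 : Set (GaloisRepresentations.ideleGroup K)}
    (h𝓕 : IsFundamentalDomain (GaloisRepresentations.principalIdeles K) 𝓕 ν)
    {f : ℝ → ℝ≥0∞} (hf : Measurable f) :
    ∫⁻ x in 𝓕, f (logNorm K x) ∂ν = idelicCovolume K ν * ∫⁻ u, f u := by
  have h := setLIntegral_comp_logNorm_eq ν h𝓕 MeasurableSet.univ hf
  rwa [Set.preimage_univ, Set.univ_inter, Measure.restrict_univ] at h

/-- **`ν(𝓕 ∩ 𝕀_K¹) = 0`**: the norm-one ideles inside a fundamental domain are `ν`-null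
(`V · vol{0} = 0`). [folklore] -/
theorem measure_logNorm_preimage_singleton_inter_eq_zero (ν : Measure (GaloisRepresentations.ideleGroup K))
    [ν.IsMulLeftInvariant] [IsFiniteMeasureOnCompacts ν] {𝓕 : Set (GaloisRepresentations.ideleGroup K)}
    (h𝓕 : IsFundamentalDomain (GaloisRepresentations.principalIdeles K) 𝓕 ν) (u : ℝ) :
    ν (logNorm K ⁻¹' {u} ∩ 𝓕) = 0 := by
  rw [← normProfile_apply ν 𝓕 (measurableSet_singleton u), normProfile_eq_smul_volume ν h𝓕,
    Measure.smul_apply, Real.volume_singleton, smul_zero]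

section Bochner

variable {E : Type*} [NormedAddCommGroup E] [NormedSpace ℝ E]

omit [NormedSpace ℝ E] in
/-- **Integrability along the norm**: `x ↦ f(log |x|)` is integrable on `{log |x| ∈ B} ∩ 𝓕` iff
`f` is integrable on `B` (`0 < V < ∞`). [folklore] -/
theorem integrableOn_comp_logNorm_iff (ν : Measure (GaloisRepresentations.ideleGroup K)) [ν.IsMulLeftInvariant]
    [IsFiniteMeasureOnCompacts ν] [ν.IsOpenPosMeasure] {𝓕 : Set (GaloisRepresentations.ideleGroup K)}
    (h𝓕 : IsFundamentalDomain (GaloisRepresentations.principalIdeles K) 𝓕 ν) {B : Set ℝ}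
    (hB : MeasurableSet B) {f : ℝ → E} (hf : AEStronglyMeasurable f (volume.restrict B)) :
    IntegrableOn (fun x => f (logNorm K x)) (logNorm K ⁻¹' B ∩ 𝓕) ν ↔ IntegrableOn f B volume := by
  have hf' : AEStronglyMeasurable f (Measure.map (logNorm K) (ν.restrict (logNorm K ⁻¹' B ∩ 𝓕))) := by
    rw [map_logNorm_restrict_eq ν h𝓕 hB]
    exact hf.smul_measure _
  rw [IntegrableOn]
  show Integrable (f ∘ logNorm K) _ ↔ _
  rw [← integrable_map_measure hf' (continuous_logNorm K).measurable.aemeasurable,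
    map_logNorm_restrict_eq ν h𝓕 hB, integrable_smul_measure (idelicCovolume_ne_zero ν)
      (idelicCovolume_ne_top ν)]
  rfl

/-- **Integration along the norm, Bochner version**: for `f` a.e. strongly measurable on `B`,
`∫_{{log |x| ∈ B} ∩ 𝓕} f(log |x|) dν = V ∫_B f(u) du`. [folklore] -/
theorem setIntegral_comp_logNorm_eq (ν : Measure (GaloisRepresentations.ideleGroup K)) [ν.IsMulLeftInvariant]
    [IsFiniteMeasureOnCompacts ν] {𝓕 : Set (GaloisRepresentations.ideleGroup K)}
    (h𝓕 : IsFundamentalDomain (GaloisRepresentations.principalIdeles K) 𝓕 ν) {B : Set ℝ}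
    (hB : MeasurableSet B) {f : ℝ → E} (hf : AEStronglyMeasurable f (volume.restrict B)) :
    ∫ x in logNorm K ⁻¹' B ∩ 𝓕, f (logNorm K x) ∂ν = (idelicCovolume K ν).toReal • ∫ u in B, f u := by
  have hf' : AEStronglyMeasurable f (Measure.map (logNorm K) (ν.restrict (logNorm K ⁻¹' B ∩ 𝓕))) := by
    rw [map_logNorm_restrict_eq ν h𝓕 hB]
    exact hf.smul_measure _
  rw [← integral_map (continuous_logNorm K).measurable.aemeasurable hf',
    map_logNorm_restrict_eq ν h𝓕 hB, integral_smul_measure]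

/-- The whole fundamental domain: `∫_𝓕 f(log |x|) dν = V ∫_ℝ f(u) du`. [folklore] -/
theorem integral_comp_logNorm_eq (ν : Measure (GaloisRepresentations.ideleGroup K)) [ν.IsMulLeftInvariant]
    [IsFiniteMeasureOnCompacts ν] {𝓕 : Set (GaloisRepresentations.ideleGroup K)}
    (h𝓕 : IsFundamentalDomain (GaloisRepresentations.principalIdeles K) 𝓕 ν) {f : ℝ → E}
    (hf : AEStronglyMeasurable f volume) :
    ∫ x in 𝓕, f (logNorm K x) ∂ν = (idelicCovolume K ν).toReal • ∫ u, f u := by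
  have h := setIntegral_comp_logNorm_eq ν h𝓕 MeasurableSet.univ (f := f) (by rwa [Measure.restrict_univ])
  rwa [Set.preimage_univ, Set.univ_inter, Measure.restrict_univ] at h

end Bochner

/-! ### Tate's formulas -/

/-- **`ν(𝓕 ∩ 𝕀_K¹) = 0`.** [folklore] -/
theorem measure_setOf_ideleNorm_eq_one_inter_eq_zero (ν : Measure (GaloisRepresentations.ideleGroup K))
    [ν.IsMulLeftInvariant] [IsFiniteMeasureOnCompacts ν] {𝓕 : Set (GaloisRepresentations.ideleGroup K)}
    (h𝓕 : IsFundamentalDomain (GaloisRepresentations.principalIdeles K) 𝓕 ν) :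
    ν ({x : GaloisRepresentations.ideleGroup K | (IdeleClassGroup.ideleNorm K x : ℝ) = 1} ∩ 𝓕) = 0 := by
  rw [setOf_ideleNorm_eq_one_eq]
  exact measure_logNorm_preimage_singleton_inter_eq_zero ν h𝓕 0

/-- **Tate's formula above the unit norm**: for `re s > 0`,
`∫_{𝓕 ∩ {|x| ≥ 1}} |x|^{-s} dν(x) = V / s`, the integral converging absolutely
(`|x|^{-s} = e^{-s u}`, `∫_0^∞ e^{-su} du = 1/s`) — the reflected (`𝔟 → 1/𝔟`) form of
"`∫₀¹ κ t^s dt/t = κ/s`" in the proof of Tate's Main Theorem 4.4.1 (Lemma B and the auxiliary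
integrals, PDF p. 368). [cite: CasselsFrohlichANT1967, Ch. XV Thm. 4.4.1 (proof)] -/
theorem integrableOn_and_setIntegral_ideleNorm_cpow_neg (ν : Measure (GaloisRepresentations.ideleGroup K))
    [ν.IsMulLeftInvariant] [IsFiniteMeasureOnCompacts ν] [ν.IsOpenPosMeasure]
    {𝓕 : Set (GaloisRepresentations.ideleGroup K)}
    (h𝓕 : IsFundamentalDomain (GaloisRepresentations.principalIdeles K) 𝓕 ν) {s : ℂ} (hs : 0 < s.re) :
    IntegrableOn (fun x => ((IdeleClassGroup.ideleNorm K x : ℝ) : ℂ) ^ (-s))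
        ({x | 1 ≤ (IdeleClassGroup.ideleNorm K x : ℝ)} ∩ 𝓕) ν ∧
      ∫ x in {x | 1 ≤ (IdeleClassGroup.ideleNorm K x : ℝ)} ∩ 𝓕,
          ((IdeleClassGroup.ideleNorm K x : ℝ) : ℂ) ^ (-s) ∂ν = (idelicCovolume K ν).toReal / s := by
  have hs' : (-s).re < 0 := by simpa using hs
  have hfun : (fun x : GaloisRepresentations.ideleGroup K => ((IdeleClassGroup.ideleNorm K x : ℝ) : ℂ) ^ (-s)) =
      fun x => (fun u : ℝ => Complex.exp (-s * u)) (logNorm K x) := by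
    funext x; exact ideleNorm_cpow_eq_exp x (-s)
  have hcont : Continuous fun u : ℝ => Complex.exp (-s * u) :=
    Complex.continuous_exp.comp (continuous_const.mul Complex.continuous_ofReal)
  rw [setOf_one_le_ideleNorm_eq, hfun]
  refine ⟨?_, ?_⟩
  · rw [integrableOn_comp_logNorm_iff ν h𝓕 measurableSet_Ici hcont.aestronglyMeasurable]
    rw [integrableOn_Ici_iff_integrableOn_Ioi]
    exact integrableOn_exp_mul_complex_Ioi hs' 0
  · rw [setIntegral_comp_logNorm_eq ν h𝓕 measurableSet_Ici hcont.aestronglyMeasurable,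
      integral_Ici_eq_integral_Ioi, integral_exp_mul_complex_Ioi hs' 0]
    simp only [Complex.ofReal_zero, mul_zero, Complex.exp_zero, Complex.real_smul]
    field_simp

/-- **Tate's formula below the unit norm**: for `re s > 0`,
`∫_{𝓕 ∩ {|x| ≤ 1}} |x|^{s} dν(x) = V / s`, the integral converging absolutely:
"`∫_E c(t𝔟) d𝔟 = κ t^s` if `c(𝔞) = |𝔞|^s`" (Lemma B) and "`∫₀¹ κ f(0) t^s dt/t = κ f(0)/s`" in
the proof of Tate's Main Theorem 4.4.1 (PDF pp. 367–368).
[cite: CasselsFrohlichANT1967, Ch. XV Thm. 4.4.1 (proof, Lemma B)] -/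
theorem integrableOn_and_setIntegral_ideleNorm_cpow (ν : Measure (GaloisRepresentations.ideleGroup K))
    [ν.IsMulLeftInvariant] [IsFiniteMeasureOnCompacts ν] [ν.IsOpenPosMeasure]
    {𝓕 : Set (GaloisRepresentations.ideleGroup K)}
    (h𝓕 : IsFundamentalDomain (GaloisRepresentations.principalIdeles K) 𝓕 ν) {s : ℂ} (hs : 0 < s.re) :
    IntegrableOn (fun x => ((IdeleClassGroup.ideleNorm K x : ℝ) : ℂ) ^ s)
        ({x | (IdeleClassGroup.ideleNorm K x : ℝ) ≤ 1} ∩ 𝓕) ν ∧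
      ∫ x in {x | (IdeleClassGroup.ideleNorm K x : ℝ) ≤ 1} ∩ 𝓕,
          ((IdeleClassGroup.ideleNorm K x : ℝ) : ℂ) ^ s ∂ν = (idelicCovolume K ν).toReal / s := by
  have hfun : (fun x : GaloisRepresentations.ideleGroup K => ((IdeleClassGroup.ideleNorm K x : ℝ) : ℂ) ^ s) =
      fun x => (fun u : ℝ => Complex.exp (s * u)) (logNorm K x) := by
    funext x; exact ideleNorm_cpow_eq_exp x s
  have hcont : Continuous fun u : ℝ => Complex.exp (s * u) :=
    Complex.continuous_exp.comp (continuous_const.mul Complex.continuous_ofReal)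
  rw [setOf_ideleNorm_le_one_eq, hfun]
  refine ⟨?_, ?_⟩
  · rw [integrableOn_comp_logNorm_iff ν h𝓕 measurableSet_Iic hcont.aestronglyMeasurable]
    exact integrableOn_exp_mul_complex_Iic hs 0
  · rw [setIntegral_comp_logNorm_eq ν h𝓕 measurableSet_Iic hcont.aestronglyMeasurable,
      integral_exp_mul_complex_Iic hs 0]
    simp only [Complex.ofReal_zero, mul_zero, Complex.exp_zero, Complex.real_smul]
    field_simp

end Profile

/-! ### Unfolding `𝕀_K` over `Kˣ` onto a fundamental domain -/

section Unfolding

/-- `Kˣ ≅` the principal ideles (`K → 𝔸_K` is injective). [folklore] -/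
def principalIdelesEquiv : Kˣ ≃* GaloisRepresentations.principalIdeles K :=
  MonoidHom.ofInjective (f := (principalIdele K : Kˣ →* GaloisRepresentations.ideleGroup K))
    (Units.map_injective (AdeleRing.algebraMap_injective (𝓞 K) K))

/-- The equivalence is `k ↦ principalIdele K k` on underlying ideles. [folklore] -/
@[simp]
theorem coe_principalIdelesEquiv (k : Kˣ) :
    ((principalIdelesEquiv K k : GaloisRepresentations.principalIdeles K) : GaloisRepresentations.ideleGroup K) =
      principalIdele K k := rfl

variable {K}
variable [MeasurableSpace (GaloisRepresentations.ideleGroup K)] [BorelSpace (GaloisRepresentations.ideleGroup K)]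

/-- **Unfolding, `ℝ≥0∞` version**: `∫⁻_{𝕀_K} f dν = ∫⁻_𝓕 ∑_{k ∈ Kˣ} f(k x) dν(x)` for a
fundamental domain `𝓕` of `Kˣ`, a `Kˣ`-invariant measure `ν` and measurable `f ≥ 0` (Mathlib
`IsFundamentalDomain.lintegral_eq_tsum''` and Tonelli). [folklore] -/
theorem lintegral_eq_setLIntegral_tsum_smul (ν : Measure (GaloisRepresentations.ideleGroup K)) [ν.IsMulLeftInvariant]
    {𝓕 : Set (GaloisRepresentations.ideleGroup K)}
    (h𝓕 : IsFundamentalDomain (GaloisRepresentations.principalIdeles K) 𝓕 ν)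
    {f : GaloisRepresentations.ideleGroup K → ℝ≥0∞} (hf : AEMeasurable f ν) :
    ∫⁻ x, f x ∂ν = ∫⁻ x in 𝓕, ∑' k : GaloisRepresentations.principalIdeles K, f (k • x) ∂ν := by
  haveI : MeasurableMul (GaloisRepresentations.ideleGroup K) := by
    haveI := secondCountableTopology_ideleGroup K
    infer_instance
  rw [h𝓕.lintegral_eq_tsum'' f, lintegral_tsum]
  exact fun k =>
    (hf.comp_quasiMeasurePreserving (measurePreserving_smul k ν).quasiMeasurePreserving).restrict

/-- **Unfolding over `Kˣ`**: `∫⁻_{𝕀_K} f dν = ∫⁻_𝓕 ∑_{k ∈ Kˣ} f(ι(k) x) dν(x)` with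
`ι = principalIdele K`. [folklore] -/
theorem lintegral_eq_setLIntegral_tsum_principalIdele (ν : Measure (GaloisRepresentations.ideleGroup K))
    [ν.IsMulLeftInvariant] {𝓕 : Set (GaloisRepresentations.ideleGroup K)}
    (h𝓕 : IsFundamentalDomain (GaloisRepresentations.principalIdeles K) 𝓕 ν)
    {f : GaloisRepresentations.ideleGroup K → ℝ≥0∞} (hf : AEMeasurable f ν) :
    ∫⁻ x, f x ∂ν = ∫⁻ x in 𝓕, ∑' k : Kˣ, f (principalIdele K k * x) ∂ν := by
  rw [lintegral_eq_setLIntegral_tsum_smul ν h𝓕 hf]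
  refine lintegral_congr fun x => ?_
  rw [← (principalIdelesEquiv K).tsum_eq]
  rfl

variable {E : Type*} [NormedAddCommGroup E] [NormedSpace ℝ E]

/-- **Unfolding, Bochner version**: for `f ∈ L¹(𝕀_K, ν)`,
`∫_{𝕀_K} f dν = ∫_𝓕 ∑_{k ∈ Kˣ} f(k x) dν(x)`, the inner series converging absolutely for
a.e. `x ∈ 𝓕` (Mathlib `IsFundamentalDomain.integral_eq_tsum''` and `integral_tsum`; the
finiteness `∑_k ∫_𝓕 ‖f(k x)‖ = ∫ ‖f‖ < ∞` is the `ℝ≥0∞` unfolding). [folklore] -/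
theorem integral_eq_setIntegral_tsum_smul (ν : Measure (GaloisRepresentations.ideleGroup K)) [ν.IsMulLeftInvariant]
    {𝓕 : Set (GaloisRepresentations.ideleGroup K)}
    (h𝓕 : IsFundamentalDomain (GaloisRepresentations.principalIdeles K) 𝓕 ν)
    {f : GaloisRepresentations.ideleGroup K → E} (hf : Integrable f ν) :
    ∫ x, f x ∂ν = ∫ x in 𝓕, ∑' k : GaloisRepresentations.principalIdeles K, f (k • x) ∂ν := by
  haveI : MeasurableMul (GaloisRepresentations.ideleGroup K) := by
    haveI := secondCountableTopology_ideleGroup K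
    infer_instance
  rw [h𝓕.integral_eq_tsum'' f hf, ← integral_tsum]
  · exact fun k =>
      (hf.1.comp_quasiMeasurePreserving (measurePreserving_smul k ν).quasiMeasurePreserving).restrict
  · rw [← h𝓕.lintegral_eq_tsum'' fun x => ‖f x‖ₑ]
    exact hf.2.ne

/-- **Unfolding over `Kˣ`, Bochner version**: `∫_{𝕀_K} f dν = ∫_𝓕 ∑_{k ∈ Kˣ} f(ι(k) x) dν(x)`
for `f ∈ L¹(𝕀_K, ν)`, `ι = principalIdele K`. [folklore] -/
theorem integral_eq_setIntegral_tsum_principalIdele (ν : Measure (GaloisRepresentations.ideleGroup K))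
    [ν.IsMulLeftInvariant] {𝓕 : Set (GaloisRepresentations.ideleGroup K)}
    (h𝓕 : IsFundamentalDomain (GaloisRepresentations.principalIdeles K) 𝓕 ν)
    {f : GaloisRepresentations.ideleGroup K → E} (hf : Integrable f ν) :
    ∫ x, f x ∂ν = ∫ x in 𝓕, ∑' k : Kˣ, f (principalIdele K k * x) ∂ν := by
  rw [integral_eq_setIntegral_tsum_smul ν h𝓕 hf]
  refine integral_congr_ae (Eventually.of_forall fun x => ?_)
  show ∑' k : GaloisRepresentations.principalIdeles K, f (k • x) = _
  rw [← (principalIdelesEquiv K).tsum_eq]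
  rfl

end Unfolding

end Literature.NumberTheory.Automorphic
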